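import Summits.PneNP.PneNP.Theorems.RamseyUncertifiableResolutionUncertaintyOfCore
import Summits.PneNP.PneNP.Theorems.RamseyUncertifiableResolutionUncertaintyDenseCliques
import Summits.PneNP.PneNP.Theorems.RamseyUncertifiableResolutionUncertaintyTreeLike

/-!
# The TREE-LIKE rung of `RamseyUncertifiable.ResolutionUncertainty` — item stmt-PneNP-9816 (support), proved

`treeLike_resolutionUncertainty`: there are `ε > 0` and `n₀` such that for every graph `G` on `n ≥ n₀` vertices,
every TREE-LIKE resolution refutation `π₁` of the unary `Clique(G, ⌈log₂ n²⌉)` has length `≥ n^{ε log₂ n}` as soon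
as `Clique(Gᶜ, ⌈log₂ n²⌉)` has any resolution refutation (i.e. as soon as `G` is 2-Ramsey at the Erdős threshold).
This is the item's inequality `n^{ε log₂ n} ≤ max(|π₁|, |π₂|)` for tree-like `π₁` (the general, dag-like, case is
the open problem of Atserias et al. arXiv:2012.09476 §9 / Lauria–Pudlák–Rödl–Thapen arXiv:1303.3166 §1.1; the
tree-like case for Ramsey graphs is LPRT Thm 4, proved there by `Res(k)`-simulation of the binary encoding).

Proof assembled from landed pieces: soundness (`cliqueFree_of_refutation`) makes `G` and `Gᶜ` both
`⌈log₂ n²⌉`-clique-free; the Prömel–Rödl core (`stub_promelRodl ∘ stub_drcStep`) is a set `S`, `s = |S| ≥ n^{3/4}`,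
inside which `G` is `δ`-dense between disjoint `s^{1-β}`-subsets; `pow_le_factorial_mul_card_cliqueFinset` gives
`(3M)^T ≤ T!·#(T-cliques)` for `M = ⌈s^{1-β}⌉`, `T = ⌊c log₂ s⌋`, `c = β/(2 log₂(4/δ))`; tree-like refutations
enumerate cliques (`treelike_cliqueCNF_length_ge_card_cliqueFinset`): `#(T-cliques) ≤ |π₁|`; the numerics
(`room_of_large`, `levels_of_large`, `exponent_of_count`) turn this into `|π₁| ≥ 2^{((1-β)c/4) log₂² s} ≥ n^{ε log₂ n}`
with `ε = (9/16)(1-β)c/4`, for `log₂ s` beyond three explicit thresholds (`exists_threshold`).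
-/

set_option linter.dupNamespace false

namespace Summit.PneNP.PneNP.Theorems.RamseyUncertifiableResolutionUncertainty

open Literature.Computability.Complexity Literature.Computability.MetaComplexity
open Summit.PneNP.PneNP.Theorems.RegularResolutionRung.Negative (cliqueCNF)

/-! ## Numerics in `s = |S|` (with `L = log₂ s`) -/

section Numerics

/-- Powers of `s` as powers of `2`: `s^x = 2^{(log₂ s)·x}` for `s > 0`. -/
theorem rpow_eq_two_rpow {s : ℝ} (hs : 0 < s) (x : ℝ) : s ^ x = (2 : ℝ) ^ (Real.logb 2 s * x) := by
  conv_lhs => rw [← Real.rpow_logb two_pos (by norm_num) hs]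
  rw [← Real.rpow_mul (by norm_num)]

/-- `log₂ (4/δ) ≥ 2` for `0 < δ ≤ 1`. -/
theorem two_le_logb_four_div {δ : ℝ} (hδ0 : 0 < δ) (hδ1 : δ ≤ 1) : 2 ≤ Real.logb 2 (4 / δ) := by
  have h4 : (4 : ℝ) ≤ 4 / δ := by
    rw [le_div_iff₀ hδ0]; nlinarith
  calc (2 : ℝ) = Real.logb 2 4 := by
        rw [show (4 : ℝ) = 2 ^ (2 : ℝ) by norm_num, Real.logb_rpow two_pos (by norm_num)]
    _ ≤ Real.logb 2 (4 / δ) := Real.logb_le_logb_of_le one_lt_two (by norm_num) h4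

/-- `(δ/4)^{cL} = 2^{-βL/2}` for `c = β / (2 log₂(4/δ))`. -/
theorem base_rpow_eq {β δ : ℝ} (hδ0 : 0 < δ) (hδ1 : δ ≤ 1) (L : ℝ) :
    (δ / 4) ^ (β / (2 * Real.logb 2 (4 / δ)) * L) = (2 : ℝ) ^ (-(β / 2) * L) := by
  have ha : 2 ≤ Real.logb 2 (4 / δ) := two_le_logb_four_div hδ0 hδ1
  have ha0 : Real.logb 2 (4 / δ) ≠ 0 := by linarith
  have hb : (0 : ℝ) < δ / 4 := by positivity
  rw [rpow_eq_two_rpow hb]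
  congr 1
  have : Real.logb 2 (δ / 4) = -Real.logb 2 (4 / δ) := by
    rw [← Real.logb_inv]
    congr 1
    field_simp
  rw [this]
  field_simp

/-- ROOM: `4⌈s^{1-β}⌉ ≤ (δ/4)^T · s` once `log₂ s ≥ 6/β` and `T ≤ c log₂ s`. -/
theorem room_of_large {β δ : ℝ} (hβ0 : 0 < β) (hβ1 : β < 1) (hδ0 : 0 < δ) (hδ1 : δ ≤ 1) {s : ℕ} (hs : 2 ≤ s)
    {T : ℕ} (hT : (T : ℝ) ≤ β / (2 * Real.logb 2 (4 / δ)) * Real.logb 2 s) (hL : 6 / β ≤ Real.logb 2 s) :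
    (4 * (⌈(s : ℝ) ^ (1 - β)⌉₊ : ℝ)) ≤ (δ / 4) ^ T * s := by
  set L := Real.logb 2 (s : ℝ) with hLdef
  have hs0 : (0 : ℝ) < s := by exact_mod_cast lt_of_lt_of_le (by norm_num) hs
  have hs1 : (1 : ℝ) ≤ s := by exact_mod_cast le_trans (by norm_num) hs
  have hs2 : (s : ℝ) = 2 ^ L := (Real.rpow_logb two_pos (by norm_num) hs0).symm
  -- `4M ≤ 8 s^{1-β} = 2^{3 + L(1-β)}`
  have hpow1 : (1 : ℝ) ≤ (s : ℝ) ^ (1 - β) := Real.one_le_rpow hs1 (by linarith)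
  have hM : (⌈(s : ℝ) ^ (1 - β)⌉₊ : ℝ) ≤ 2 * (s : ℝ) ^ (1 - β) := by
    have := Nat.ceil_lt_add_one (Real.rpow_nonneg hs0.le (1 - β))
    linarith
  have hlhs : (4 * (⌈(s : ℝ) ^ (1 - β)⌉₊ : ℝ)) ≤ (2 : ℝ) ^ (3 + L * (1 - β)) := by
    calc (4 * (⌈(s : ℝ) ^ (1 - β)⌉₊ : ℝ)) ≤ 8 * (s : ℝ) ^ (1 - β) := by linarith
      _ = (2 : ℝ) ^ (3 : ℝ) * (2 : ℝ) ^ (L * (1 - β)) := by rw [rpow_eq_two_rpow hs0, ← hLdef]; norm_num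
      _ = (2 : ℝ) ^ (3 + L * (1 - β)) := by rw [← Real.rpow_add two_pos]
  -- `(δ/4)^T s ≥ 2^{-βL/2} 2^L`
  have hb0 : (0 : ℝ) < δ / 4 := by positivity
  have hb1 : δ / 4 ≤ 1 := by linarith
  have hrhs : (2 : ℝ) ^ (L - β / 2 * L) ≤ (δ / 4) ^ T * s := by
    have h1 : (δ / 4) ^ (β / (2 * Real.logb 2 (4 / δ)) * L) ≤ (δ / 4) ^ T := by
      rw [← Real.rpow_natCast]
      exact Real.rpow_le_rpow_of_exponent_ge hb0 hb1 hT
    rw [base_rpow_eq hδ0 hδ1] at h1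
    calc (2 : ℝ) ^ (L - β / 2 * L) = (2 : ℝ) ^ (-(β / 2) * L) * (2 : ℝ) ^ L := by
          rw [← Real.rpow_add two_pos]; ring_nf
      _ ≤ (δ / 4) ^ T * (2 : ℝ) ^ L := mul_le_mul_of_nonneg_right h1 (by positivity)
      _ = (δ / 4) ^ T * s := by rw [← hs2]
  -- compare exponents
  have hexp : 3 + L * (1 - β) ≤ L - β / 2 * L := by
    have : 6 ≤ β * L := by
      have := (div_le_iff₀ hβ0).1 hL
      linarith
    nlinarith
  exact hlhs.trans ((Real.rpow_le_rpow_of_exponent_le one_le_two hexp).trans hrhs)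

/-- FEW LEVELS: `T ≤ 3 √⌈s^{1-β}⌉` once `T ≤ c log₂ s` and `log₂ s ≥ 16c / (3 (1-β)² (log 2)²)`. -/
theorem levels_of_large {β c : ℝ} (hβ1 : β < 1) {s : ℕ} (hs : 2 ≤ s) {T : ℕ}
    (hT : (T : ℝ) ≤ c * Real.logb 2 s)
    (hL : 16 * c / (3 * (1 - β) ^ 2 * (Real.log 2) ^ 2) ≤ Real.logb 2 s) :
    (T : ℝ) ≤ 3 * Real.sqrt (⌈(s : ℝ) ^ (1 - β)⌉₊ : ℝ) := by
  set L := Real.logb 2 (s : ℝ) with hLdef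
  have hs0 : (0 : ℝ) < s := by exact_mod_cast lt_of_lt_of_le (by norm_num) hs
  have hlog2 : 0 < Real.log 2 := Real.log_pos one_lt_two
  have h1β : 0 < 1 - β := by linarith
  have hL0 : 0 ≤ L := Real.logb_nonneg one_lt_two (by exact_mod_cast le_trans (by norm_num) hs)
  -- `√M ≥ s^{(1-β)/2} = exp v`, `v = L (1-β) log 2 / 2`
  set v : ℝ := L * (1 - β) * Real.log 2 / 2 with hv
  have hv0 : 0 ≤ v := by positivity
  have hsqrt : Real.exp v ≤ Real.sqrt (⌈(s : ℝ) ^ (1 - β)⌉₊ : ℝ) := by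
    have hceil : (s : ℝ) ^ (1 - β) ≤ (⌈(s : ℝ) ^ (1 - β)⌉₊ : ℝ) := Nat.le_ceil _
    have h1 : Real.sqrt ((s : ℝ) ^ (1 - β)) ≤ Real.sqrt (⌈(s : ℝ) ^ (1 - β)⌉₊ : ℝ) := Real.sqrt_le_sqrt hceil
    refine le_trans (le_of_eq ?_) h1
    rw [Real.sqrt_eq_rpow, ← Real.rpow_mul hs0.le, rpow_eq_two_rpow hs0, Real.rpow_def_of_pos two_pos]
    congr 1
    rw [hv]; ring
  -- `exp v ≥ (1 + v/2)^2 ≥ 3v²/4 …`; we use `exp v ≥ v²/4`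
  have hexp : v ^ 2 / 4 ≤ Real.exp v := by
    have h := Real.add_one_le_exp (v / 2)
    have h2 : (v / 2 + 1) ^ 2 ≤ Real.exp (v / 2) ^ 2 := pow_le_pow_left₀ (by positivity) h 2
    rw [← Real.exp_nat_mul] at h2
    have : ((2 : ℕ) : ℝ) * (v / 2) = v := by push_cast; ring
    rw [this] at h2
    nlinarith
  -- it suffices that `c L ≤ 3 v² / 4`, i.e. `v ≥ 8c / (3 (1-β) log 2)` in terms of `L`
  have hcL : c * L ≤ 3 * (v ^ 2 / 4) := by
    have hLv : L = 2 * v / ((1 - β) * Real.log 2) := by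
      rw [hv]; field_simp
    -- `v ≥ 8c/(3(1-β) log 2)`
    have hvlow : 8 * c / (3 * (1 - β) * Real.log 2) ≤ v := by
      rw [hv]
      have := hL
      rw [div_le_iff₀ (by positivity)] at this
      rw [div_le_iff₀ (by positivity)]
      nlinarith [hlog2, h1β]
    rw [hLv]
    rw [div_le_iff₀ (by positivity)] at hvlow
    have : c * (2 * v / ((1 - β) * Real.log 2)) = 2 * c * v / ((1 - β) * Real.log 2) := by ring
    rw [this, div_le_iff₀ (by positivity)]
    nlinarith [hv0, hlog2, h1β]
  calc (T : ℝ) ≤ c * L := hT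
    _ ≤ 3 * (v ^ 2 / 4) := hcL
    _ ≤ 3 * Real.exp v := by linarith
    _ ≤ 3 * Real.sqrt (⌈(s : ℝ) ^ (1 - β)⌉₊ : ℝ) := by linarith

/-- COUNT TO EXPONENT: from `(3M)^T ≤ T!·C`, `T ≤ 3√M`, `T ≥ cL - 1`, `cL ≥ 2` get `2^{((1-β)c/4) L²} ≤ C`. -/
theorem exponent_of_count {β c : ℝ} (hβ1 : β < 1) (hc : 0 < c) {s : ℕ} (hs : 2 ≤ s) {M T C : ℕ}
    (hM : M = ⌈(s : ℝ) ^ (1 - β)⌉₊) (hcount : (3 * M) ^ T ≤ T.factorial * C)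
    (hTle : (T : ℝ) ≤ 3 * Real.sqrt M) (hTge : c * Real.logb 2 s - 1 ≤ T) (hL : 2 / c ≤ Real.logb 2 s) :
    (2 : ℝ) ^ ((1 - β) * c / 4 * Real.logb 2 s ^ 2) ≤ C := by
  set L := Real.logb 2 (s : ℝ) with hLdef
  have hs0 : (0 : ℝ) < s := by exact_mod_cast lt_of_lt_of_le (by norm_num) hs
  have hL0 : 0 ≤ L := Real.logb_nonneg one_lt_two (by exact_mod_cast le_trans (by norm_num) hs)
  have h1β : 0 < 1 - β := by linarith
  have hM0 : (0 : ℝ) ≤ M := Nat.cast_nonneg M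
  -- (1) `(√M)^T ≤ C`
  have hsq : Real.sqrt M ^ T ≤ C := by
    have hfac : (0 : ℝ) < T.factorial := by exact_mod_cast T.factorial_pos
    have h1 : (T.factorial : ℝ) * Real.sqrt M ^ T ≤ ((T : ℝ) * Real.sqrt M) ^ T := by
      rw [mul_pow]
      refine mul_le_mul_of_nonneg_right ?_ (by positivity)
      exact_mod_cast Nat.factorial_le_pow T
    have h2 : ((T : ℝ) * Real.sqrt M) ^ T ≤ ((3 * M : ℕ) : ℝ) ^ T := by
      refine pow_le_pow_left₀ (by positivity) ?_ T
      push_cast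
      calc (T : ℝ) * Real.sqrt M ≤ 3 * Real.sqrt M * Real.sqrt M :=
            mul_le_mul_of_nonneg_right hTle (Real.sqrt_nonneg _)
        _ = 3 * M := by rw [mul_assoc, Real.mul_self_sqrt hM0]
    have h3 : ((3 * M : ℕ) : ℝ) ^ T ≤ (T.factorial : ℝ) * C := by exact_mod_cast hcount
    have := (h1.trans h2).trans h3
    exact le_of_mul_le_mul_left this hfac
  -- (2) `√M ≥ 2^{L(1-β)/2}`
  have hsqrtM : (2 : ℝ) ^ (L * ((1 - β) / 2)) ≤ Real.sqrt M := by
    have hceil : (s : ℝ) ^ (1 - β) ≤ (M : ℝ) := by rw [hM]; exact Nat.le_ceil _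
    calc (2 : ℝ) ^ (L * ((1 - β) / 2)) = Real.sqrt ((s : ℝ) ^ (1 - β)) := by
          rw [Real.sqrt_eq_rpow, ← Real.rpow_mul hs0.le, rpow_eq_two_rpow hs0, ← hLdef]
          congr 1
          ring
      _ ≤ Real.sqrt M := Real.sqrt_le_sqrt hceil
  -- (3) `(√M)^T ≥ 2^{L(1-β)/2 · T} ≥ 2^{((1-β)c/4) L²}`
  have hpowT : (2 : ℝ) ^ (L * ((1 - β) / 2) * T) ≤ Real.sqrt M ^ T := by
    rw [Real.rpow_mul_natCast (by norm_num)]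
    exact pow_le_pow_left₀ (by positivity) hsqrtM T
  have hexp : (1 - β) * c / 4 * L ^ 2 ≤ L * ((1 - β) / 2) * T := by
    have hcL : 2 ≤ c * L := by
      have := (div_le_iff₀ hc).1 hL
      linarith
    have hT2 : c * L / 2 ≤ T := by linarith
    have : (1 - β) * c / 4 * L ^ 2 = L * ((1 - β) / 2) * (c * L / 2) := by ring
    rw [this]
    exact mul_le_mul_of_nonneg_left hT2 (by positivity)
  calc (2 : ℝ) ^ ((1 - β) * c / 4 * L ^ 2) ≤ (2 : ℝ) ^ (L * ((1 - β) / 2) * T) :=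
        Real.rpow_le_rpow_of_exponent_le one_le_two hexp
    _ ≤ Real.sqrt M ^ T := hpowT
    _ ≤ C := hsq

/-- The thresholds in `log₂ s`, eventually. -/
theorem exists_threshold (Λ : ℝ) : ∃ S₀ : ℕ, 2 ≤ S₀ ∧ ∀ s : ℕ, S₀ ≤ s → Λ ≤ Real.logb 2 s := by
  have h1 : ∀ᶠ s : ℕ in Filter.atTop, Λ ≤ Real.logb 2 (s : ℝ) :=
    ((Real.tendsto_logb_atTop one_lt_two).comp tendsto_natCast_atTop_atTop).eventually_ge_atTop Λ
  have h2 : ∀ᶠ s : ℕ in Filter.atTop, 2 ≤ s := Filter.eventually_ge_atTop 2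
  obtain ⟨S₀, hS₀⟩ := Filter.eventually_atTop.1 (h2.and h1)
  exact ⟨max S₀ 2, le_max_right _ _, fun s hs => (hS₀ s (le_trans (le_max_left _ _) hs)).2⟩

end Numerics

/-! ## The tree-like rung -/

/-- **`ResolutionUncertainty` holds for TREE-LIKE refutations (the tree-like rung, proved).** There are `ε > 0` and
`n₀` such that for every graph `G` on `n ≥ n₀` vertices, if `π₁` is a tree-like resolution refutation of the unary
`Clique(G, ⌈log₂ n²⌉)` and `Clique(Gᶜ, ⌈log₂ n²⌉)` has any resolution refutation `π₂`, then `|π₁| ≥ n^{ε log₂ n}`.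
Proof: both sides `K_k`-free (soundness) ⇒ Prömel–Rödl core `S`, `|S| ≥ n^{3/4}`, with `G` `δ`-dense between disjoint
`|S|^{1-β}`-subsets ⇒ `≥ (3M)^T/T!` cliques of size `T = Θ(log |S|)` ⇒ (tree-like refutations enumerate cliques)
`|π₁| ≥ |S|^{ε' log₂ |S|} ≥ n^{ε log₂ n}`. The analogue for Ramsey graphs of Lauria–Pudlák–Rödl–Thapen
arXiv:1303.3166 Thm 4 (there via `Res(k)`-simulation of the binary encoding). -/
theorem treeLike_resolutionUncertainty :
    ∃ ε : ℝ, 0 < ε ∧ ∃ n₀ : ℕ, ∀ n ≥ n₀, ∀ (G : SimpleGraph (Fin n)) [DecidableRel G.Adj],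
      ∀ π₁ π₂ : List (ResLine ℕ),
        IsResRefutation (cliqueCNF n (Nat.clog 2 (n ^ 2)) fun u v => decide (G.Adj u v)) π₁ → IsTreeLike π₁ →
        IsResRefutation (cliqueCNF n (Nat.clog 2 (n ^ 2)) fun u v => decide (Gᶜ.Adj u v)) π₂ →
        (n : ℝ) ^ (ε * Real.logb 2 n) ≤ π₁.length := by
  -- the core
  obtain ⟨β, δ₀, hβ0, hβ1, hδ₀, n₁, hcore⟩ := stub_promelRodl stub_drcStep
  set δ : ℝ := min δ₀ 1 with hδdef
  have hδ0 : 0 < δ := lt_min hδ₀ one_pos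
  have hδ1 : δ ≤ 1 := min_le_right _ _
  have hδle : δ ≤ δ₀ := min_le_left _ _
  -- constants
  set a : ℝ := Real.logb 2 (4 / δ) with ha
  have ha2 : 2 ≤ a := two_le_logb_four_div hδ0 hδ1
  set c : ℝ := β / (2 * a) with hc
  have hc0 : 0 < c := by positivity
  set Λ : ℝ := max (6 / β) (max (16 * c / (3 * (1 - β) ^ 2 * (Real.log 2) ^ 2)) (2 / c)) with hΛ
  obtain ⟨S₀, hS₀2, hS₀⟩ := exists_threshold Λ
  set ε' : ℝ := (1 - β) * c / 4 with hε'
  have hε'0 : 0 < ε' := by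
    have : 0 < 1 - β := by linarith
    positivity
  refine ⟨9 / 16 * ε', by positivity, max n₁ (S₀ ^ 2), ?_⟩
  intro n hn G inst π₁ π₂ h₁ htree h₂
  have hn₁ : n₁ ≤ n := le_trans (le_max_left _ _) hn
  have hnS : S₀ ^ 2 ≤ n := le_trans (le_max_right _ _) hn
  have hn4 : 4 ≤ n := le_trans (by nlinarith) hnS
  have hn1 : (1 : ℝ) ≤ n := by exact_mod_cast le_trans (by norm_num) hn4
  have hnpos : (0 : ℝ) < n := by linarith
  set k : ℕ := Nat.clog 2 (n ^ 2) with hk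
  -- soundness on both sides, then the core
  have hfree : G.CliqueFree k := cliqueFree_of_refutation G h₁
  have hfreeC : Gᶜ.CliqueFree k := cliqueFree_of_refutation Gᶜ h₂
  obtain ⟨S, hS, hdense⟩ := hcore n hn₁ G hfree hfreeC
  set s : ℕ := S.card with hsdef
  -- `s ≥ S₀`
  have hsS₀ : S₀ ≤ s := by
    have h1 : ((S₀ : ℝ)) ≤ (n : ℝ) ^ ((1 : ℝ) / 2) := by
      rw [← Real.sqrt_eq_rpow, Real.le_sqrt (by positivity) (by positivity)]
      exact_mod_cast hnS
    have h2 : (n : ℝ) ^ ((1 : ℝ) / 2) ≤ (n : ℝ) ^ ((3 : ℝ) / 4) :=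
      Real.rpow_le_rpow_of_exponent_le hn1 (by norm_num)
    exact_mod_cast (h1.trans h2).trans hS
  have hs2 : 2 ≤ s := le_trans hS₀2 hsS₀
  have hs0 : (0 : ℝ) < s := by exact_mod_cast lt_of_lt_of_le (by norm_num) hs2
  have hΛs : Λ ≤ Real.logb 2 s := hS₀ s hsS₀
  have hL1 : 6 / β ≤ Real.logb 2 s := le_trans (le_max_left _ _) hΛs
  have hL2 : 16 * c / (3 * (1 - β) ^ 2 * (Real.log 2) ^ 2) ≤ Real.logb 2 s :=
    le_trans (le_trans (le_max_left _ _) (le_max_right _ _)) hΛs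
  have hL3 : 2 / c ≤ Real.logb 2 s := le_trans (le_trans (le_max_right _ _) (le_max_right _ _)) hΛs
  -- scale, levels
  set M : ℕ := ⌈(s : ℝ) ^ (1 - β)⌉₊ with hMdef
  have hM1 : 1 ≤ M := by
    rw [hMdef, Nat.one_le_ceil_iff]
    exact Real.rpow_pos_of_pos hs0 _
  set T : ℕ := ⌊c * Real.logb 2 s⌋₊ with hTdef
  have hcL0 : 0 ≤ c * Real.logb 2 s :=
    mul_nonneg hc0.le (Real.logb_nonneg one_lt_two (by exact_mod_cast le_trans (by norm_num) hs2))
  have hTle : (T : ℝ) ≤ c * Real.logb 2 s := Nat.floor_le hcL0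
  have hTge : c * Real.logb 2 s - 1 ≤ T := by
    have := Nat.lt_floor_add_one (c * Real.logb 2 s)
    rw [← hTdef] at this
    linarith
  -- density at scale `M` (one-sided) inside `S`
  have hdenseM : ∀ A ⊆ S, ∀ B ⊆ S, Disjoint A B → M ≤ A.card → M ≤ B.card → δ ≤ (G.edgeDensity A B : ℝ) := by
    intro A hA B hB hAB hMA hMB
    have hA' : (S.card : ℝ) ^ (1 - β) ≤ A.card := le_trans (Nat.le_ceil _) (by exact_mod_cast hMA)
    have hB' : (S.card : ℝ) ^ (1 - β) ≤ B.card := le_trans (Nat.le_ceil _) (by exact_mod_cast hMB)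
    exact hδle.trans (hdense A hA B hB hAB hA' hB').1
  -- room and the count
  have hroom : (4 * M : ℝ) ≤ (δ / 4) ^ T * S.card := room_of_large hβ0 hβ1 hδ0 hδ1 hs2 hTle hL1
  have hcount := pow_le_factorial_mul_card_cliqueFinset G S M T δ hδ0 (by linarith) hM1 hdenseM hroom
  -- tree-like refutations enumerate cliques
  have htl := treelike_cliqueCNF_length_ge_card_cliqueFinset G π₁ T h₁ htree
  -- numerics
  have hlev : (T : ℝ) ≤ 3 * Real.sqrt M := by
    rw [hMdef]; exact levels_of_large hβ1 hs2 hTle hL2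
  have hexp := exponent_of_count hβ1 hc0 hs2 rfl hcount hlev hTge hL3
  -- `n^{(9/16) ε' log₂ n} ≤ 2^{ε' (log₂ s)²}`
  have hx0 : 0 ≤ Real.logb 2 n := Real.logb_nonneg one_lt_two hn1
  have h34 : 3 / 4 * Real.logb 2 n ≤ Real.logb 2 s := by
    have := Real.logb_le_logb_of_le (b := 2) one_lt_two (by positivity) hS
    rwa [Real.logb_rpow_eq_mul_logb_of_pos hnpos] at this
  have hmain : (n : ℝ) ^ (9 / 16 * ε' * Real.logb 2 n) ≤ (2 : ℝ) ^ (ε' * Real.logb 2 s ^ 2) := by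
    rw [rpow_eq_two_rpow hnpos]
    refine Real.rpow_le_rpow_of_exponent_le one_le_two ?_
    have : Real.logb 2 n * (9 / 16 * ε' * Real.logb 2 n) = ε' * (3 / 4 * Real.logb 2 n) ^ 2 := by ring
    rw [this]
    refine mul_le_mul_of_nonneg_left ?_ hε'0.le
    exact pow_le_pow_left₀ (by positivity) h34 2
  calc (n : ℝ) ^ (9 / 16 * ε' * Real.logb 2 n) ≤ (2 : ℝ) ^ (ε' * Real.logb 2 s ^ 2) := hmain
    _ ≤ ((G.cliqueFinset T).card : ℝ) := by rw [hε']; exact hexp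
    _ ≤ π₁.length := by exact_mod_cast htl

/-- The item's own shape restricted to tree-like refutations on BOTH sides (immediate from
`treeLike_resolutionUncertainty`, which needs tree-likeness of `π₁` only): `n^{ε log₂ n} ≤ max(|π₁|, |π₂|)`. -/
theorem treeLike_resolutionUncertainty_max :
    ∃ ε : ℝ, 0 < ε ∧ ∃ n₀ : ℕ, ∀ n ≥ n₀, ∀ (G : SimpleGraph (Fin n)) [DecidableRel G.Adj],
      ∀ π₁ π₂ : List (ResLine ℕ),
        IsResRefutation (cliqueCNF n (Nat.clog 2 (n ^ 2)) fun u v => decide (G.Adj u v)) π₁ → IsTreeLike π₁ →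
        IsResRefutation (cliqueCNF n (Nat.clog 2 (n ^ 2)) fun u v => decide (Gᶜ.Adj u v)) π₂ → IsTreeLike π₂ →
        (n : ℝ) ^ (ε * Real.logb 2 n) ≤ max (π₁.length : ℝ) (π₂.length : ℝ) := by
  obtain ⟨ε, hε, n₀, h⟩ := treeLike_resolutionUncertainty
  exact ⟨ε, hε, n₀, fun n hn G _ π₁ π₂ h₁ ht₁ h₂ _ => (h n hn G π₁ π₂ h₁ ht₁ h₂).trans (le_max_left _ _)⟩

end Summit.PneNP.PneNP.Theorems.RamseyUncertifiableResolutionUncertainty
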